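import Mathlib
import HarnessLib
import Literature.MathematicalPhysics.QuantumLattice.FermiRG.BGM2003Sectors

/-!
# Route `KLProgramme` — K3 engine (stmt-HubbardSuperconductivity-20437), stub (b) (ℓ)/(I2)–(I3), located item «ABS-UMK-COUNT»:
# the SECTOR GRID IN A CHART — sector centres in a narrow cone, read through a bi-Lipschitz chart coordinate, form a separated bounded set

Cell gate-hubbard-kl, seat p4 g15 (route HOME/prover-p4/UV-REMEASURE-COUNT.md §5, step (1): «the angular grid maps to an `h′`-separated point set»).
The sector centres `θ_{n,ω} = (ω + ½)·w_n` (`w_n = π/2^n`, `ω < 2^{n+1}`) lying within torus distance `Ψ` of a base angle `θ⋆` are parametrised by their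
representatives `rep(θ_{n,ω} − θ⋆) ∈ [−Ψ, Ψ]` (`rep x = x − round(x/2π)·2π`, so `|rep x| = ‖x‖_{𝕋¹}`); two DISTINCT such centres have representatives at
distance `≥ w_n` (they differ by a nonzero integer multiple of `w_n`); hence under any coordinate `U` with `m|φ − φ′| ≤ |U φ − U φ′| ≤ M|φ − φ′|` on
`[−Φ, Φ] ⊇ [−Ψ, Ψ]` and `U 0 = 0` the chart values `U(rep(θ_{n,ω} − θ⋆))` are pairwise `≥ m·w_n` apart and bounded by `M·Ψ`:

* `torusDist_eq_abs_rep` — `‖x‖_{𝕋¹} = |rep x|`;  `rep_sectorCenter_sub_eq` — `rep(θ_{n,ω} − θ⋆) = θ_{n,ω} − θ⋆ − j·2π` for an integer `j`;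
* `sectorWidth_le_abs_rep_sub_rep` — distinct centres within torus distance `Ψ < π/2`… (any `Ψ` with `|rep| + |rep′| < 2π − w` suffices; stated for
  representatives of absolute value `≤ π/2`): `w_n ≤ |rep(θ_{n,ω} − θ⋆) − rep(θ_{n,ω′} − θ⋆)|`;
* **`sectorGrid_chart_separated`** / **`sectorGrid_chart_bounded`** / `sectorGrid_chart_injOn` — the three facts above for the chart values.

Everything is PROVED; no definitions, no named facts; elementary. [folklore]
-/

noncomputable section

open Real Set
open Literature.MathematicalPhysics.QuantumLattice Literature.MathematicalPhysics.QuantumLattice.FermiRG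

namespace Summit.HubbardSuperconductivity.HubbardSuperconductivity.Theorems.AbsUmklappCount

set_option linter.dupNamespace false -- summit = problem name (single-conjunct summit), D-0017

/-! ## §1 Representatives modulo `2π` -/

/-- `‖x‖_{𝕋¹} = |x − round(x/2π)·2π|`. [folklore] -/
theorem torusDist_eq_abs_rep (x : ℝ) : torusDist x = |x - round ((2 * π)⁻¹ * x) * (2 * π)| := by
  rw [torusDist, AddCircle.norm_eq]

/-- The representative is within `π` of zero: `|x − round(x/2π)·2π| ≤ π`. [folklore] -/
theorem abs_rep_le_pi (x : ℝ) : |x - round ((2 * π)⁻¹ * x) * (2 * π)| ≤ π := by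
  have h := abs_sub_round ((2 * π)⁻¹ * x)
  have hπ : 0 < 2 * π := by positivity
  have e : x - round ((2 * π)⁻¹ * x) * (2 * π) = (2 * π) * ((2 * π)⁻¹ * x - round ((2 * π)⁻¹ * x)) := by
    field_simp
  rw [e, abs_mul, abs_of_pos hπ]
  nlinarith [Real.pi_pos]

/-- Two sector centres of the same scale whose representatives (relative to a common base angle) coincide are equal: more precisely the difference of
the representatives is `z·w_n` with `z = ω − ω′ − (j − j′)·2^{n+1}` an integer, nonzero when `ω ≠ ω′` (`|ω − ω′| < 2^{n+1}`), so distinct centres have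
representatives at distance `≥ w_n`. [folklore] -/
theorem sectorWidth_le_abs_rep_sub_rep (n : ℕ) (θs : ℝ) {ω ω' : ℕ} (hω : ω < sectorCount n) (hω' : ω' < sectorCount n) (hne : ω ≠ ω') :
    sectorWidth n ≤ |(sectorCenter n ω - θs - round ((2 * π)⁻¹ * (sectorCenter n ω - θs)) * (2 * π)) -
      (sectorCenter n ω' - θs - round ((2 * π)⁻¹ * (sectorCenter n ω' - θs)) * (2 * π))| := by
  set j : ℤ := round ((2 * π)⁻¹ * (sectorCenter n ω - θs)) with hj
  set j' : ℤ := round ((2 * π)⁻¹ * (sectorCenter n ω' - θs)) with hj'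
  have hw := sectorWidth_pos n
  have hNw : (sectorCount n : ℝ) * sectorWidth n = 2 * π := sectorCount_mul_sectorWidth n
  -- the difference is an integer multiple of the width
  set z : ℤ := (ω : ℤ) - (ω' : ℤ) - (j - j') * (sectorCount n : ℤ) with hz
  have hdiff : (sectorCenter n ω - θs - (j : ℝ) * (2 * π)) - (sectorCenter n ω' - θs - (j' : ℝ) * (2 * π)) = (z : ℝ) * sectorWidth n := by
    rw [hz]; push_cast
    simp only [sectorCenter]
    rw [← hNw]; ring
  rw [hdiff, abs_mul, abs_of_pos hw]
  -- `z ≠ 0`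
  have hz0 : z ≠ 0 := by
    intro h0
    have h1 : ((ω : ℤ) - (ω' : ℤ)) = (j - j') * (sectorCount n : ℤ) := by rw [hz] at h0; linarith
    have hlt : |((ω : ℤ) - (ω' : ℤ))| < (sectorCount n : ℤ) := by
      rw [abs_lt]; constructor <;> omega
    rw [h1, abs_mul, Nat.abs_cast] at hlt
    have h2 : |j - j'| < 1 := by
      by_contra hcon
      rw [not_lt] at hcon
      have hN : (0 : ℤ) < (sectorCount n : ℤ) := by exact_mod_cast sectorCount_pos n
      have := mul_le_mul_of_nonneg_right hcon hN.le
      linarith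
    have h3 : j - j' = 0 := Int.abs_lt_one_iff.1 h2
    rw [h3, zero_mul] at h1
    exact hne (by exact_mod_cast (sub_eq_zero.1 h1))
  have hz1 : (1 : ℝ) ≤ |(z : ℝ)| := by
    rw [← Int.cast_abs]; exact_mod_cast Int.one_le_abs hz0
  calc sectorWidth n = 1 * sectorWidth n := (one_mul _).symm
    _ ≤ |(z : ℝ)| * sectorWidth n := mul_le_mul_of_nonneg_right hz1 hw.le

/-! ## §2 The sector grid read through a bi-Lipschitz chart coordinate -/

/-- **Separation of the chart values of distinct sector centres in a cone.**  If `U` satisfies `m·|φ − φ′| ≤ |U φ − U φ′|` on `[−Φ, Φ]` and two distinct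
sector centres `θ_{n,ω} ≠ θ_{n,ω′}` have representatives `rep(θ_{n,·} − θ⋆) ∈ [−Φ, Φ]`, then `m·w_n ≤ |U(rep_ω) − U(rep_{ω′})|`. [folklore] -/
theorem sectorGrid_chart_separated {U : ℝ → ℝ} {Φ m : ℝ} (hm : 0 ≤ m)
    (hlow : ∀ φ ∈ Icc (-Φ) Φ, ∀ φ' ∈ Icc (-Φ) Φ, m * |φ - φ'| ≤ |U φ - U φ'|)
    (n : ℕ) (θs : ℝ) {ω ω' : ℕ} (hω : ω < sectorCount n) (hω' : ω' < sectorCount n) (hne : ω ≠ ω')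
    (hrep : sectorCenter n ω - θs - round ((2 * π)⁻¹ * (sectorCenter n ω - θs)) * (2 * π) ∈ Icc (-Φ) Φ)
    (hrep' : sectorCenter n ω' - θs - round ((2 * π)⁻¹ * (sectorCenter n ω' - θs)) * (2 * π) ∈ Icc (-Φ) Φ) :
    m * sectorWidth n ≤ |U (sectorCenter n ω - θs - round ((2 * π)⁻¹ * (sectorCenter n ω - θs)) * (2 * π)) -
      U (sectorCenter n ω' - θs - round ((2 * π)⁻¹ * (sectorCenter n ω' - θs)) * (2 * π))| := by
  have h1 := sectorWidth_le_abs_rep_sub_rep n θs hω hω' hne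
  have h2 := hlow _ hrep _ hrep'
  exact (mul_le_mul_of_nonneg_left h1 hm).trans h2

/-- **Boundedness of the chart values in a cone**: if `|U φ − U φ′| ≤ M|φ − φ′|` on `[−Φ, Φ]`, `U 0 = 0`, `0 ≤ Φ`, and the representative has absolute
value `≤ Ψ ≤ Φ`, then `|U(rep)| ≤ M·Ψ`. [folklore] -/
theorem sectorGrid_chart_bounded {U : ℝ → ℝ} {Φ Ψ M : ℝ} (hM : 0 ≤ M) (hΦ : 0 ≤ Φ) (hΨΦ : Ψ ≤ Φ)
    (hup : ∀ φ ∈ Icc (-Φ) Φ, ∀ φ' ∈ Icc (-Φ) Φ, |U φ - U φ'| ≤ M * |φ - φ'|) (hU0 : U 0 = 0)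
    {x : ℝ} (hx : |x| ≤ Ψ) : |U x| ≤ M * Ψ := by
  have hxΦ : x ∈ Icc (-Φ) Φ := by
    have := abs_le.1 (hx.trans hΨΦ); exact ⟨this.1, this.2⟩
  have h0 : (0 : ℝ) ∈ Icc (-Φ) Φ := ⟨by linarith, hΦ⟩
  have h := hup x hxΦ 0 h0
  rw [hU0, sub_zero, sub_zero] at h
  exact h.trans (mul_le_mul_of_nonneg_left hx hM)

/-- A sector centre within torus distance `Ψ` of `θ⋆` has representative of absolute value `≤ Ψ`. [folklore] -/
theorem abs_rep_le_of_torusDist_le {n : ℕ} {ω : ℕ} {θs Ψ : ℝ} (h : torusDist (sectorCenter n ω - θs) ≤ Ψ) :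
    |sectorCenter n ω - θs - round ((2 * π)⁻¹ * (sectorCenter n ω - θs)) * (2 * π)| ≤ Ψ := by
  rwa [torusDist_eq_abs_rep] at h

/-- **Injectivity**: on the sector labels of one scale whose centres lie within torus distance `Ψ ≤ Φ` of `θ⋆`, the map
`ω ↦ U(rep(θ_{n,ω} − θ⋆))` is injective (`m > 0`). [folklore] -/
theorem sectorGrid_chart_injOn {U : ℝ → ℝ} {Φ Ψ m : ℝ} (hm : 0 < m) (hΨΦ : Ψ ≤ Φ)
    (hlow : ∀ φ ∈ Icc (-Φ) Φ, ∀ φ' ∈ Icc (-Φ) Φ, m * |φ - φ'| ≤ |U φ - U φ'|)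
    (n : ℕ) (θs : ℝ) :
    Set.InjOn (fun ω : Fin (sectorCount n) =>
        U (sectorCenter n ω - θs - round ((2 * π)⁻¹ * (sectorCenter n ω - θs)) * (2 * π)))
      {ω : Fin (sectorCount n) | torusDist (sectorCenter n ω - θs) ≤ Ψ} := by
  intro ω hω ω' hω' hU
  by_contra hne
  have hne' : (ω : ℕ) ≠ (ω' : ℕ) := fun h => hne (Fin.ext h)
  have hr : ∀ o : Fin (sectorCount n), torusDist (sectorCenter n o - θs) ≤ Ψ →
      sectorCenter n o - θs - round ((2 * π)⁻¹ * (sectorCenter n o - θs)) * (2 * π) ∈ Icc (-Φ) Φ := by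
    intro o ho
    have := abs_le.1 ((abs_rep_le_of_torusDist_le ho).trans hΨΦ)
    exact ⟨this.1, this.2⟩
  have h := sectorGrid_chart_separated hm.le hlow n θs ω.isLt ω'.isLt hne' (hr ω hω) (hr ω' hω')
  simp only at hU
  rw [hU, sub_self, abs_zero] at h
  have := mul_pos hm (sectorWidth_pos n)
  linarith

end Summit.HubbardSuperconductivity.HubbardSuperconductivity.Theorems.AbsUmklappCount

end
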